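import Mathlib.Analysis.InnerProductSpace.PiL2
import Mathlib.Analysis.SpecialFunctions.Trigonometric.Basic
import Mathlib.Algebra.BigOperators.Fin

/-!
# The regular `N`-gon as an explicit `N`-point configuration on `S¹`, every `N`: ground-state energies

Framing: lottery ticket; floor = certified bounds/negative ranges. Venture `PackingBounds` (cell
`pub-packcert`, seat `pub-packcert-energy`) — the **attained side** of Cohn–Kumar 2007, Table 1, first row,
for every `N` at once (the tree held `N = 3, 4, 5, 6`: `Polygons34`, `Pentagon`, `Hexagon`).

The vertices `(cos(2πj/N), sin(2πj/N))`, `j < N`, are `N` unit vectors of `ℝ²` with `⟨p_j, p_{j'}⟩ = cos(2π(j-j')/N)`;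
for every potential `a` their energy is `N Σ_{l=1}^{N-1} a(cos(2πl/N))` (`energy_pts`, `exists_config`). With the
universal optimality of the regular `N`-gon (`Energy.UniversalPolygon.universallyOptimal_of_absolutelyMonotoneOn`, every
`N ≥ 2`) this is the ground-state energy of `N` points on the circle for every absolutely monotonic potential
(`RegularPolygonUnique.energy_isLeast`, where also the uniqueness of the ground state is proved).

## References
* H. Cohn, A. Kumar, J. Amer. Math. Soc. 20 (2007) 99–148, Thm. 1.2, Table 1 (first row). [`CohnKumar2006`]
-/

noncomputable section

namespace Summit.Ventures.PackingBounds.Config.RegularPolygon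

open Finset

/-- The angle of the `j`-th vertex, `2πj/N`. [folklore] -/
def ang (N j : ℕ) : ℝ := 2 * Real.pi * j / N

/-- The `j`-th vertex `(cos(2πj/N), sin(2πj/N))` of the regular `N`-gon. [cite: CohnKumar2006, Table 1] -/
def pt (N : ℕ) (j : Fin N) : EuclideanSpace ℝ (Fin 2) := !₂[Real.cos (ang N j), Real.sin (ang N j)]

/-- The regular `N`-gon as a finite configuration. [cite: CohnKumar2006, Table 1] -/
def pts (N : ℕ) : Finset (EuclideanSpace ℝ (Fin 2)) := (univ : Finset (Fin N)).image (pt N)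

/-- `⟨p_j, p_{j'}⟩ = cos(2π(j - j')/N)`. [folklore] -/
theorem inner_pt (N : ℕ) (j j' : Fin N) :
    inner ℝ (pt N j) (pt N j') = Real.cos (2 * Real.pi * ((j : ℝ) - j') / N) := by
  have h : inner ℝ (pt N j) (pt N j') =
      Real.cos (ang N j') * Real.cos (ang N j) + Real.sin (ang N j') * Real.sin (ang N j) := by
    simp [pt, EuclideanSpace.inner_toLp_toLp, dotProduct, Fin.sum_univ_two]
  rw [h, show 2 * Real.pi * ((j : ℝ) - j') / N = ang N j - ang N j' by unfold ang; ring, Real.cos_sub]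
  ring

/-- The vertices are unit vectors. [folklore] -/
theorem norm_pt (N : ℕ) (j : Fin N) : ‖pt N j‖ = 1 := by
  have h : inner ℝ (pt N j) (pt N j) = 1 := by rw [inner_pt, sub_self]; simp
  rw [real_inner_self_eq_norm_sq] at h
  nlinarith [norm_nonneg (pt N j)]

/-- Distinct indices give distinct vertices. [folklore] -/
theorem pt_injective (N : ℕ) : Function.Injective (pt N) := by
  intro j j' h
  have hN : (0 : ℝ) < N := by exact_mod_cast (lt_of_le_of_lt (Nat.zero_le _) j.2)
  have hc : Real.cos (2 * Real.pi * ((j : ℝ) - j') / N) = 1 := by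
    rw [← inner_pt, h, real_inner_self_eq_norm_sq, norm_pt]; norm_num
  have hb : ∀ a b : Fin N, 2 * Real.pi * ((a : ℝ) - b) / N < 2 * Real.pi := by
    intro a b
    rw [div_lt_iff₀ hN]
    have : (a : ℝ) < N := by exact_mod_cast a.2
    have : (0 : ℝ) ≤ b := by exact_mod_cast Nat.zero_le _
    nlinarith [Real.pi_pos]
  have hlo : -(2 * Real.pi) < 2 * Real.pi * ((j : ℝ) - j') / N := by
    have := hb j' j
    rw [show 2 * Real.pi * ((j : ℝ) - j') / N = -(2 * Real.pi * ((j' : ℝ) - j) / N) by ring]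
    linarith
  have h0 := (Real.cos_eq_one_iff_of_lt_of_lt hlo (hb j j')).1 hc
  rw [div_eq_zero_iff, mul_eq_zero] at h0
  rcases h0 with (h0 | h0) | h0
  · exact absurd h0 (by positivity)
  · exact Fin.ext (by exact_mod_cast (sub_eq_zero.1 h0))
  · exact absurd h0 hN.ne'

/-- The inner product of the vertices `j` and `j - l`: `cos(2πl/N)`. [folklore] -/
theorem inner_pt_sub {n : ℕ} (j l : Fin (n + 1)) :
    inner ℝ (pt (n + 1) j) (pt (n + 1) (j - l)) = Real.cos (2 * Real.pi * (l : ℝ) / (n + 1 : ℕ)) := by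
  rw [inner_pt]
  have h := Fin.intCast_val_sub_eq_sub_add_ite j l
  have hN : ((n + 1 : ℕ) : ℝ) ≠ 0 := by positivity
  have hj : ((j : ℕ) : ℝ) - (((j - l : Fin (n + 1)) : ℕ) : ℝ) =
      (l : ℝ) - (if l ≤ j then (0 : ℝ) else ((n + 1 : ℕ) : ℝ)) := by
    have h' : ((((j - l : Fin (n + 1)) : ℕ) : ℤ) : ℝ) =
        (((j : ℕ) : ℤ) : ℝ) - (((l : ℕ) : ℤ) : ℝ) + ((if l ≤ j then (0 : ℤ) else ((n + 1 : ℕ) : ℤ) : ℤ) : ℝ) := by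
      rw [h]; push_cast; rfl
    push_cast at h'
    split_ifs at h' ⊢ with hle
    · simp only [add_zero] at h'; linarith
    · push_cast at h' ⊢; linarith
  rw [hj]
  split_ifs
  · rw [sub_zero]
  · rw [show 2 * Real.pi * ((l : ℝ) - ((n + 1 : ℕ) : ℝ)) / ((n + 1 : ℕ) : ℝ) =
      2 * Real.pi * (l : ℝ) / ((n + 1 : ℕ) : ℝ) - 2 * Real.pi by field_simp, Real.cos_sub_two_pi]

/-- The energy seen from one vertex: `Σ_{j' ≠ j} a(⟨p_j, p_{j'}⟩) = Σ_{l=1}^{N-1} a(cos(2πl/N))`. [folklore] -/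
theorem sum_erase_pt {n : ℕ} (a : ℝ → ℝ) (j : Fin (n + 1)) :
    ∑ j' ∈ (univ : Finset (Fin (n + 1))).erase j, a (inner ℝ (pt (n + 1) j) (pt (n + 1) j')) =
      ∑ l ∈ range n, a (Real.cos (2 * Real.pi * ((l + 1 : ℕ) : ℝ) / (n + 1 : ℕ))) := by
  have htot : ∑ j' : Fin (n + 1), a (inner ℝ (pt (n + 1) j) (pt (n + 1) j')) =
      ∑ l : Fin (n + 1), a (inner ℝ (pt (n + 1) j) (pt (n + 1) (j - l))) :=
    (Equiv.sum_comp (Equiv.subLeft j) (fun j' => a (inner ℝ (pt (n + 1) j) (pt (n + 1) j')))).symm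
  rw [Finset.sum_erase_eq_sub (Finset.mem_univ j), htot, Fin.sum_univ_succ, sub_zero,
    Finset.sum_congr rfl fun l _ => by rw [inner_pt_sub], add_sub_cancel_left,
    ← Fin.sum_univ_eq_sum_range (fun l => a (Real.cos (2 * Real.pi * ((l + 1 : ℕ) : ℝ) / (n + 1 : ℕ)))) n]
  refine Finset.sum_congr rfl fun l _ => ?_
  rw [Fin.val_succ]

/-- `|pts N| = N`. [folklore] -/
theorem card_pts (N : ℕ) : (pts N).card = N := by
  rw [pts, Finset.card_image_of_injective _ (pt_injective N), card_univ, Fintype.card_fin]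

/-- The vertices are unit vectors. [folklore] -/
theorem norm_of_mem_pts {N : ℕ} {x : EuclideanSpace ℝ (Fin 2)} (hx : x ∈ pts N) : ‖x‖ = 1 := by
  obtain ⟨j, -, rfl⟩ := Finset.mem_image.1 hx
  exact norm_pt N j

/-- **The energy of the regular `N`-gon** is `N Σ_{l=1}^{N-1} a(cos(2πl/N))` for every potential `a`.
[cite: CohnKumar2006, Table 1] -/
theorem energy_pts {N : ℕ} (hN : 1 ≤ N) (a : ℝ → ℝ) :
    ∑ x ∈ pts N, ∑ y ∈ (pts N).erase x, a (inner ℝ x y) =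
      (N : ℝ) * ∑ l ∈ range (N - 1), a (Real.cos (2 * Real.pi * ((l + 1 : ℕ) : ℝ) / N)) := by
  classical
  obtain ⟨n, rfl⟩ : ∃ n, N = n + 1 := ⟨N - 1, by omega⟩
  rw [pts, Finset.sum_image fun j _ j' _ h => pt_injective (n + 1) h]
  have hterm : ∀ j : Fin (n + 1),
      ∑ y ∈ ((univ : Finset (Fin (n + 1))).image (pt (n + 1))).erase (pt (n + 1) j),
        a (inner ℝ (pt (n + 1) j) y) = ∑ l ∈ range n, a (Real.cos (2 * Real.pi * ((l + 1 : ℕ) : ℝ) / (n + 1 : ℕ))) := by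
    intro j
    rw [← Finset.image_erase (pt_injective (n + 1)), Finset.sum_image fun j _ j' _ h => pt_injective (n + 1) h]
    exact sum_erase_pt a j
  simp only [hterm, sum_const, card_univ, Fintype.card_fin, nsmul_eq_mul, Nat.add_sub_cancel]

/-- **The regular `N`-gon configuration.** For every `N ≥ 1` there are `N` unit vectors of `ℝ²` whose `a`-energy
is `N Σ_{l=1}^{N-1} a(cos(2πl/N))` for every potential `a`. [cite: CohnKumar2006, Table 1] -/
theorem exists_config {N : ℕ} (hN : 1 ≤ N) : ∃ C : Finset (EuclideanSpace ℝ (Fin 2)), C.card = N ∧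
    (∀ x ∈ C, ‖x‖ = 1) ∧
    ∀ a : ℝ → ℝ, ∑ x ∈ C, ∑ y ∈ C.erase x, a (inner ℝ x y) =
      (N : ℝ) * ∑ l ∈ range (N - 1), a (Real.cos (2 * Real.pi * ((l + 1 : ℕ) : ℝ) / N)) :=
  ⟨pts N, card_pts N, fun _ hx => norm_of_mem_pts hx, energy_pts hN⟩

end Summit.Ventures.PackingBounds.Config.RegularPolygon

end
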